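import Summits.CriticalPhenomena.PercolationContinuityZ3.Theorems.PercNearOneGluingNoHeavyLowerTailAntitheticFan6NotOplusShift
import HarnessLib

/-!
# `NoHeavyLowerTail` (stmt-CriticalPhenomena-4575) — antithetic cluster pairs: **THE PENDANT PROBE OF THE TOP EVENT — TOP_shift FAILS at a
# pendant vertex hung at the hub of the 6-fan** (so "CONJECTURE T" — TOP_shift(K; P) ≥ 0 for every rooted graph and every vertex — is
# false from 9 vertices on, although it holds for every connected rooted graph on ≤ 6 vertices; prim-hp-2 gen 69, HOME/MEMO-gen69.md §3)

Support file (`--supports stmt-CriticalPhenomena-4575`, hull-port prover `prim-hp-2`, gen 69).  No definitions, no named facts, no sorries;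
COMPUTATIONAL (`native_decide` evaluates one integer sum over the `2^14` sub-colourings; clusters by the BFS ball `reachN` of
…AntitheticReachN).  A negative result: it kills no item and no theorem; it fixes the range of the hypothesis TOP_shift of
…AntitheticTopEar (THEOREM T-EAR) and …AntitheticTopVertex (`TopVertex.vertex_sum_nonneg_of_top`).

THE PENDANT PROBE.  For a vertex `P` pendant at `a ≠ s` (only pair `aP`) of `K = K' + aP`:  `P ∈ X ⟺ aP` red `∧ a ∈ X'` and
`P ∉ Y ⟺ ¬(aP` blue `∧ a ∈ Y')` (`X', Y'` the clusters of `K'`), so the TOP event `{P ∈ X, P ∉ Y}` is `{aP red} × {a ∈ X'}` and the TOP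
sum of `(K, P)` is the ⊕_shift sum of `(K', a)` (with `F⁺, G⁺` shifted by `P`): every ⊕_shift failure of an anchor reappears as a TOP failure
one pendant edge further out — exactly as the mixed sums (M) inherit ⊕ failures through a pendant edge at `s` (HOME/MEMO-gen58, "pendant
probe").  Here `K' =` the 6-fan from its hub (`Antithetic.Fan6.exists_negative_shift_pair`, …AntitheticFan6NotOplusShift: −46).
* `Antithetic.Fan6Pendant.exists_negative_top_pair` — for `E = {01, …, 07, 12, …, 17, 18}` on `Fin 9` (source `0`, hub `1`, leaves `2–7`,
  `P = 8` pendant at the hub) and `F⁺ = F⁻ = 𝟙[{5,6,7} ⊆ ·]`, `G⁺ = G⁻ = 𝟙[{2,3,4} ⊆ ·]`: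
  `Σ_{θ ⊆ E : 8 ∈ X θ, 8 ∉ Y θ} (F⁺(X θ) − F⁻(Y θ))·(G⁺(X θ) − G⁻(Y θ)) = −46 < 0`.
* `Antithetic.Fan6Pendant.not_top_shift_powerset` — hence TOP_shift(E; 8) fails.  (The |R| = 1 vertex antithetic inequality at `P = 8` holds
  trivially — `D({8})` is everything for a pendant vertex —: the sum on `{8 ∉ Y}` compensates the mirror of the top event; BOTTOM, NOTY are
  nonnegative there, HOME/MEMO-gen69.md §3.)  Smallest instance of the phenomenon: `K_{2,5}` + pendant at the pole (8 vertices, −3 in the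
  kit's normalisation).  CONJECTURE T2 of the memo restricts TOP_shift to pairs `(s, P)` not separated by a cut vertex.
[cite: VandenbergHaggstromKahn2005, §1 p. 3 (open cluster `C_s`)]
-/

namespace Summit.CriticalPhenomena.PercolationContinuityZ3.Theorems

open Literature.Probability.Percolation

namespace Antithetic

namespace Fan6Pendant

set_option maxRecDepth 8192 in
/-- **An explicit nested monotone pair with NEGATIVE TOP_shift sum: the 6-fan with a pendant vertex at the hub, target the pendant vertex.**
With `F⁺ = F⁻ = 𝟙[{5,6,7} ⊆ ·]`, `G⁺ = G⁻ = 𝟙[{2,3,4} ⊆ ·]`: `Σ_{θ ⊆ E : 8 ∈ X θ, 8 ∉ Y θ} (F⁺(X θ) − F⁻(Y θ))·(G⁺(X θ) − G⁻(Y θ)) = −46 < 0`,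
`E = {01, 02, …, 07, 12, …, 17, 18}` (source `0`, hub `1`, leaves `2, …, 7`, pendant `8`). [this work, checked computation] -/
theorem exists_negative_top_pair : ∃ Fp Fm Gp Gm : Set (Fin 9) → ℝ,
    Monotone Fp ∧ Monotone Fm ∧ (∀ S, Fm S ≤ Fp S) ∧ Monotone Gp ∧ Monotone Gm ∧ (∀ S, Gm S ≤ Gp S) ∧
    ∑ θ ∈ (Finset.powerset ({s(0, 1), s(0, 2), s(0, 3), s(0, 4), s(0, 5), s(0, 6), s(0, 7), s(1, 2), s(1, 3), s(1, 4), s(1, 5), s(1, 6), s(1, 7), s(1, 8)} : Finset (Sym2 (Fin 9)))).filter (fun (θ : Finset (Sym2 (Fin 9))) =>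
        (SimpleGraph.fromEdgeSet (↑θ : Set (Sym2 (Fin 9)))).Reachable 0 8
          ∧ ¬ (SimpleGraph.fromEdgeSet (↑(({s(0, 1), s(0, 2), s(0, 3), s(0, 4), s(0, 5), s(0, 6), s(0, 7), s(1, 2), s(1, 3), s(1, 4), s(1, 5), s(1, 6), s(1, 7), s(1, 8)} : Finset (Sym2 (Fin 9))) \ θ) : Set (Sym2 (Fin 9)))).Reachable 0 8),
      (Fp (openCluster (↑θ : Set (Sym2 (Fin 9))) 0) - Fm (openCluster (↑(({s(0, 1), s(0, 2), s(0, 3), s(0, 4), s(0, 5), s(0, 6), s(0, 7), s(1, 2), s(1, 3), s(1, 4), s(1, 5), s(1, 6), s(1, 7), s(1, 8)} : Finset (Sym2 (Fin 9))) \ θ) : Set (Sym2 (Fin 9))) 0)) *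
        (Gp (openCluster (↑θ : Set (Sym2 (Fin 9))) 0) - Gm (openCluster (↑(({s(0, 1), s(0, 2), s(0, 3), s(0, 4), s(0, 5), s(0, 6), s(0, 7), s(1, 2), s(1, 3), s(1, 4), s(1, 5), s(1, 6), s(1, 7), s(1, 8)} : Finset (Sym2 (Fin 9))) \ θ) : Set (Sym2 (Fin 9))) 0)) < 0 := by
  -- monotonicity of an indicator `[g ⊆ A]` through `Set.toFinset`
  have hmono : ∀ (g : Finset (Fin 9)), Monotone (fun A : Set (Fin 9) =>
      (((if g ⊆ @Set.toFinset _ A (Fintype.ofFinite A) then (1 : ℤ) else 0 : ℤ) : ℝ))) := by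
    intro g A A' hA
    have hA' : @Set.toFinset _ A (Fintype.ofFinite A) ⊆ @Set.toFinset _ A' (Fintype.ofFinite A') :=
      (@Set.toFinset_subset_toFinset _ A A' (Fintype.ofFinite A) (Fintype.ofFinite A')).2 hA
    dsimp only
    split_ifs with h1 h2
    · exact le_rfl
    · exact absurd (h1.trans hA') h2
    · exact_mod_cast zero_le_one
    · exact le_rfl
  -- cluster computations by the BFS ball `reachN`
  have hX : ∀ θ : Finset (Sym2 (Fin 9)), openCluster (↑θ : Set (Sym2 (Fin 9))) 0 = ↑(reachN θ (0 : Fin 9) 8) := fun θ =>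
    openCluster_eq_coe_reachN θ (0 : Fin 9) (by simp)
  have hD : (Finset.powerset ({s(0, 1), s(0, 2), s(0, 3), s(0, 4), s(0, 5), s(0, 6), s(0, 7), s(1, 2), s(1, 3), s(1, 4), s(1, 5), s(1, 6), s(1, 7), s(1, 8)} : Finset (Sym2 (Fin 9)))).filter (fun (θ : Finset (Sym2 (Fin 9))) =>
        (SimpleGraph.fromEdgeSet (↑θ : Set (Sym2 (Fin 9)))).Reachable 0 8
          ∧ ¬ (SimpleGraph.fromEdgeSet (↑(({s(0, 1), s(0, 2), s(0, 3), s(0, 4), s(0, 5), s(0, 6), s(0, 7), s(1, 2), s(1, 3), s(1, 4), s(1, 5), s(1, 6), s(1, 7), s(1, 8)} : Finset (Sym2 (Fin 9))) \ θ) : Set (Sym2 (Fin 9)))).Reachable 0 8) =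
      (Finset.powerset ({s(0, 1), s(0, 2), s(0, 3), s(0, 4), s(0, 5), s(0, 6), s(0, 7), s(1, 2), s(1, 3), s(1, 4), s(1, 5), s(1, 6), s(1, 7), s(1, 8)} : Finset (Sym2 (Fin 9)))).filter (fun (θ : Finset (Sym2 (Fin 9))) => (8 : Fin 9) ∈ reachN θ (0 : Fin 9) 8 ∧
          ¬ ((8 : Fin 9) ∈ reachN (({s(0, 1), s(0, 2), s(0, 3), s(0, 4), s(0, 5), s(0, 6), s(0, 7), s(1, 2), s(1, 3), s(1, 4), s(1, 5), s(1, 6), s(1, 7), s(1, 8)} : Finset (Sym2 (Fin 9))) \ θ) (0 : Fin 9) 8)) := by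
    refine Finset.filter_congr fun θ _ => ?_
    rw [mem_reachN_iff θ (0 : Fin 9) (8 : Fin 9) (by simp), mem_reachN_iff _ (0 : Fin 9) (8 : Fin 9) (by simp)]
  refine ⟨fun A => (((if ({5, 6, 7} : Finset (Fin 9)) ⊆ @Set.toFinset _ A (Fintype.ofFinite A) then (1 : ℤ) else 0 : ℤ) : ℝ)), fun A => (((if ({5, 6, 7} : Finset (Fin 9)) ⊆ @Set.toFinset _ A (Fintype.ofFinite A) then (1 : ℤ) else 0 : ℤ) : ℝ)),
    fun A => (((if ({2, 3, 4} : Finset (Fin 9)) ⊆ @Set.toFinset _ A (Fintype.ofFinite A) then (1 : ℤ) else 0 : ℤ) : ℝ)), fun A => (((if ({2, 3, 4} : Finset (Fin 9)) ⊆ @Set.toFinset _ A (Fintype.ofFinite A) then (1 : ℤ) else 0 : ℤ) : ℝ)),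
    hmono _, hmono _, fun S => le_rfl, hmono _, hmono _, fun S => le_rfl, ?_⟩
  rw [hD]
  simp only [hX, Finset.toFinset_coe]
  refine NegTools.cast_sum_neg _ _ _ _ _ ?_
  native_decide

/-- **TOP_shift fails for (6-fan + pendant at the hub; the pendant vertex)** — "CONJECTURE T" (TOP_shift for every rooted graph and
vertex) is false; the hypothesis of THEOREM T-EAR / `TopVertex.vertex_sum_nonneg_of_top` is a genuine restriction. [this work] -/
theorem not_top_shift_powerset : ¬ ∀ Fp Fm Gp Gm : Set (Fin 9) → ℝ, Monotone Fp → Monotone Fm → (∀ S, Fm S ≤ Fp S) →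
    Monotone Gp → Monotone Gm → (∀ S, Gm S ≤ Gp S) →
    0 ≤ ∑ θ ∈ (Finset.powerset ({s(0, 1), s(0, 2), s(0, 3), s(0, 4), s(0, 5), s(0, 6), s(0, 7), s(1, 2), s(1, 3), s(1, 4), s(1, 5), s(1, 6), s(1, 7), s(1, 8)} : Finset (Sym2 (Fin 9)))).filter (fun (θ : Finset (Sym2 (Fin 9))) =>
        (SimpleGraph.fromEdgeSet (↑θ : Set (Sym2 (Fin 9)))).Reachable 0 8
          ∧ ¬ (SimpleGraph.fromEdgeSet (↑(({s(0, 1), s(0, 2), s(0, 3), s(0, 4), s(0, 5), s(0, 6), s(0, 7), s(1, 2), s(1, 3), s(1, 4), s(1, 5), s(1, 6), s(1, 7), s(1, 8)} : Finset (Sym2 (Fin 9))) \ θ) : Set (Sym2 (Fin 9)))).Reachable 0 8),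
      (Fp (openCluster (↑θ : Set (Sym2 (Fin 9))) 0) - Fm (openCluster (↑(({s(0, 1), s(0, 2), s(0, 3), s(0, 4), s(0, 5), s(0, 6), s(0, 7), s(1, 2), s(1, 3), s(1, 4), s(1, 5), s(1, 6), s(1, 7), s(1, 8)} : Finset (Sym2 (Fin 9))) \ θ) : Set (Sym2 (Fin 9))) 0)) *
        (Gp (openCluster (↑θ : Set (Sym2 (Fin 9))) 0) - Gm (openCluster (↑(({s(0, 1), s(0, 2), s(0, 3), s(0, 4), s(0, 5), s(0, 6), s(0, 7), s(1, 2), s(1, 3), s(1, 4), s(1, 5), s(1, 6), s(1, 7), s(1, 8)} : Finset (Sym2 (Fin 9))) \ θ) : Set (Sym2 (Fin 9))) 0)) := by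
  intro h
  obtain ⟨Fp, Fm, Gp, Gm, hFp, hFm, hF, hGp, hGm, hG, hlt⟩ := exists_negative_top_pair
  exact absurd (h Fp Fm Gp Gm hFp hFm hF hGp hGm hG) (not_le.2 hlt)

end Fan6Pendant

end Antithetic

end Summit.CriticalPhenomena.PercolationContinuityZ3.Theorems
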